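import Literature.NumberTheory.Automorphic.QuadraticHeckeCharacterInfiniteIdeles
import Literature.NumberTheory.Automorphic.IdeleClassBaseChangeProper
import Literature.NumberTheory.Automorphic.IdeleClassGroupUnitMaps
import Literature.NumberTheory.NumberFields.CMFieldTotallyNegativeGenerator
import Mathlib.Analysis.Complex.Circle
import HarnessLib

/-!
# The quadratic Hecke character `ε_{L/L⁺}` of a CM field

Topic `NumberTheory/Automorphic`; namespace `Literature.NumberTheory.Automorphic`. Four definitions (a choice of
generator, the character, a generic `unitaryToCircle`, and the circle-valued form of the character on the idèle
class group) and their API; everything is proved, no named fact, no instance.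

Let `L` be a CM field (Mathlib `NumberField.IsCMField L`), `L⁺ = maximalRealSubfield L` its maximal (totally) real
subfield, `[L : L⁺] = 2`, `σ` the complex conjugation. By
`NumberFields.IsCMField.exists_ringOfIntegers_totallyNegative_sqrt` (`CMFieldTotallyNegativeGenerator.lean`),
`L = L⁺(√θ)` for an algebraic integer `θ ∈ 𝓞 L⁺` which is a non-square in `L⁺` and totally negative; the square
class `θ · L⁺ײ` is determined by `L/L⁺`.

* `cmQuadraticGenerator L : 𝓞 L⁺` — a choice of such a `θ` (`cmQuadraticGenerator_spec`,
  `not_isSquare_cmQuadraticGenerator`, `embedding_cmQuadraticGenerator_lt_zero`);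
* **`quadraticHeckeCharCM L : HeckeCharacter L⁺`** — `ε_{L/L⁺} := quadraticHeckeChar L⁺ θ`, the tree's quadratic
  Hecke character (`QuadraticHeckeCharacter.lean`: the sign character of the index-two open subgroup
  `P_{L⁺} · N_{L/L⁺} J_L = principalIdeles L⁺ ⊔ normIdeles L⁺ θ` of `𝕀_{L⁺}`, O'Meara 65:21; "the quadratic character
  of `L/L₀`", PerL-type arguments use it as `ε_{L/L₀}`);
* `quadraticHeckeCharCM_eq_quadraticHeckeChar` — **independence of the choice**: for EVERY presentation
  `L = L⁺(β)`, `β² = θ' ∈ 𝓞 L⁺`, `β ∉ L⁺`, `quadraticHeckeChar L⁺ θ' = quadraticHeckeCharCM L`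
  (`quadraticHeckeChar_eq_of_mul_sq` and `NumberFields.exists_mul_sq_eq_of_sq_eq`);
* values: `quadraticHeckeCharCM_apply_eq_one_iff` (kernel `P · N J`), `quadraticHeckeCharCM_apply_sq` (`ε(x)² = 1`),
  `quadraticHeckeCharCM_sq` (`ε² = 1`), `quadraticHeckeCharCM_ne_one` (`ε ≠ 1`: value `-1` on `⟨-1⟩_v` at any
  infinite place);
* **archimedean type `sgn` at every infinite place of `L⁺`** (all of them are real and `θ` is negative at each):
  `quadraticHeckeCharCM_infiniteIdeleSingle` (`ε(⟨c⟩_v) = sgn(c)`), `quadraticHeckeCharCM_infiniteIdeles`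
  (`ε(y, 1) = ∏_v sgn(y_v)` on `(L⁺ ⊗ ℝ)ˣ`);
* **unitary form on `C_{L⁺}`**: `unitaryToCircle` (a continuous quasi-character `G →ₜ* ℂˣ` with values of norm `1`
  as `G →ₜ* S¹`), `quadraticClassCharCM L : IdeleClassGroup L⁺ →ₜ* Circle` (`ε` descended to `C_{L⁺} = 𝕀/L⁺ˣ`,
  the tree's `HeckeCharacter.toIdeleClassCharacter`, then to `S¹`), `coe_quadraticClassCharCM_mk`,
  `quadraticClassCharCM_mk_eq_one_iff`, `quadraticClassCharCM_sq`, `quadraticClassCharCM_ne_one`, and its values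
  on the classes `[y]` of `y ∈ L⁺_∞ˣ` (the tree's `infUnitsToClass`): `coe_quadraticClassCharCM_infUnitsToClass`
  (`= ∏_v sgn(y_v)`) — the form consumed by the character-extension files (`IdeleClassCharacterExtension.lean`:
  `χ_A : A →* Circle`, `A = C_{L⁺}`, `f = classBaseChange L⁺ L`);
* the base change `ι : C_{L⁺} → C_L` of idèle class groups for the quadratic (Galois) extension `L/L⁺`:
  `isClosedEmbedding_classBaseChange_maximalRealSubfield` (`IdeleClassBaseChangeProper.lean`) and
  `norm_classBaseChange_maximalRealSubfield` (`‖ι c‖_L = ‖c‖²_{L⁺}`, `IdeleClassBaseChangeNorm.lean`).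

These are the inputs about `ε_{L/L₀}` and `𝔸×_{L₀} L× / L×` in the existence statement for unitary Hecke
characters of a CM field with prescribed restriction to `C_{L₀}` (e.g. PerL v5 §3.2, tex ll. 304–313: components
`sgn` at the real places, "the image of the idele class group of `L₀`, which injects continuously and properly:
norm-one classes are compact and `|·|_L = |·|²_{L₀}`"); the extension step itself is
`IdeleClassCharacterExtension.lean`.

Provenance: tree-vocabulary form of the `pub-hodgecm` package file `HodgeCM/Literature/QuadraticCharacterCM.lean`
(CITED-FACT seat gen 6: `cmGenerator`, `quadraticCharacterCM`, `…_ne_one`, `…_sq`, `…_mk_eq_one_iff`,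
`…_infUnitsToClass_zpow`, `…_canonical`), over the tree's `quadraticHeckeChar` instead of the package's
`quadraticCharacter`; the package's N15 clauses (`exists_unitaryHeckeCharacter_of_isCMField_*`) are not part of
this file.

## References

* O. T. O'Meara, *Introduction to Quadratic Forms*, Grundlehren 117 (1963), §65A Example 65:2, §65D Prop. 65:21,
  §71D proof of Thm. 71:19. [Omeara1963]
* G. Shimura, *Abelian Varieties with Complex Multiplication and Modular Functions* (1998), §18.2 (CM fields as
  `F(√-Δ)`). [folklore]
-/

noncomputable section

open scoped NumberField
open NumberField IsDedekindDomain NumberField.InfinitePlace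

namespace Literature.NumberTheory.Automorphic

open QuadraticForms GaloisRepresentations Literature.NumberTheory.NumberFields

variable (L : Type) [Field L] [NumberField L] [IsCMField L]

local notation3 "L⁺" => maximalRealSubfield L

/-! ## The generator `θ` -/

/-- **A totally negative integral generator of the CM extension**: some `θ ∈ 𝓞 L⁺`, a non-square in `L⁺`,
negative at every real place, with `L = L⁺(√θ)` (a choice; the character below does not depend on it,
`quadraticHeckeCharCM_eq_quadraticHeckeChar`). [folklore] -/
def cmQuadraticGenerator : 𝓞 L⁺ :=
  (IsCMField.exists_ringOfIntegers_totallyNegative_sqrt L).choose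

/-- `θ = α²` for some non-zero purely imaginary `α ∈ L` (`σ α = -α`). [folklore] -/
theorem cmQuadraticGenerator_spec :
    ∃ α : L, α ≠ 0 ∧ IsCMField.complexConj L α = -α ∧
      α ^ 2 = algebraMap L⁺ L (cmQuadraticGenerator L : L⁺) := by
  obtain ⟨α, h0, hc, hsq, -, -⟩ := (IsCMField.exists_ringOfIntegers_totallyNegative_sqrt L).choose_spec
  exact ⟨α, h0, hc, hsq⟩

/-- `θ` is not a square in `L⁺`. [folklore] -/
theorem not_isSquare_cmQuadraticGenerator : ¬ IsSquare (cmQuadraticGenerator L : L⁺) :=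
  (IsCMField.exists_ringOfIntegers_totallyNegative_sqrt L).choose_spec.choose_spec.2.2.2.1

/-- `θ` is totally negative: `v(θ) < 0` at every real place `v` of `L⁺`. [folklore] -/
theorem embedding_cmQuadraticGenerator_lt_zero' (v : InfinitePlace L⁺) (hv : v.IsReal) :
    embedding_of_isReal hv (cmQuadraticGenerator L : L⁺) < 0 :=
  (IsCMField.exists_ringOfIntegers_totallyNegative_sqrt L).choose_spec.choose_spec.2.2.2.2 v hv

/-- `θ` is totally negative (every infinite place of the totally real field `L⁺` is real). [folklore] -/
theorem embedding_cmQuadraticGenerator_lt_zero (v : InfinitePlace L⁺) :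
    embedding_of_isReal (IsTotallyReal.isReal v) (cmQuadraticGenerator L : L⁺) < 0 :=
  embedding_cmQuadraticGenerator_lt_zero' L v _

/-! ## The character `ε_{L/L⁺}` -/

/-- **The quadratic Hecke character `ε_{L/L⁺}` of the CM field `L`**: the tree's `quadraticHeckeChar L⁺ θ` for
`θ = cmQuadraticGenerator L` — the character of `𝕀_{L⁺}` with kernel `P_{L⁺} · N_{L/L⁺} J_L` (index `2`,
O'Meara 65:21). [cite: Omeara1963, §65D Prop. 65:21] -/
def quadraticHeckeCharCM : HeckeCharacter L⁺ :=
  quadraticHeckeChar L⁺ (cmQuadraticGenerator L) (not_isSquare_cmQuadraticGenerator L)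

/-- Unfolding. [folklore] -/
theorem quadraticHeckeCharCM_def :
    quadraticHeckeCharCM L = quadraticHeckeChar L⁺ (cmQuadraticGenerator L) (not_isSquare_cmQuadraticGenerator L) :=
  rfl

variable {L}

/-- **Kernel**: `ε(x) = 1` iff `x ∈ P_{L⁺} · N J` (principal idèles times the idèles that are local norms from
`L⁺_v(√θ)` everywhere). [cite: Omeara1963, §65A Example 65:2] -/
theorem quadraticHeckeCharCM_apply_eq_one_iff (x : ideleGroup L⁺) :
    quadraticHeckeCharCM L x = 1 ↔ x ∈ principalIdeles L⁺ ⊔ normIdeles L⁺ (cmQuadraticGenerator L : L⁺) := by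
  refine ⟨fun h => ?_, fun h => quadraticHeckeChar_apply_of_mem _ h⟩
  by_contra hx
  rw [quadraticHeckeCharCM_def, quadraticHeckeChar_apply_of_not_mem _ hx] at h
  exact (neg_ne_self.2 one_ne_zero) (Units.ext_iff.1 h)

/-- `ε(x)² = 1`. [folklore] -/
theorem quadraticHeckeCharCM_apply_sq (x : ideleGroup L⁺) : quadraticHeckeCharCM L x ^ 2 = 1 :=
  quadraticHeckeChar_apply_sq _ x

variable (L) in
/-- `ε² = 1` in the group of Hecke characters. [folklore] -/
theorem quadraticHeckeCharCM_sq : quadraticHeckeCharCM L ^ 2 = 1 :=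
  HeckeCharacter.ext fun x => by rw [HeckeCharacter.pow_apply, quadraticHeckeCharCM_apply_sq, HeckeCharacter.one_apply]

/-! ## Independence of the choice of `θ` -/

variable (L) in
/-- **`ε_{L/L⁺}` does not depend on the presentation `L = L⁺(√θ')`.** If `β ∈ L ∖ L⁺` has `β² = θ' ∈ 𝓞 L⁺` then
`quadraticHeckeChar L⁺ θ' = quadraticHeckeCharCM L` (`θ' = θ r²` with `r ∈ L⁺`, and the character only depends
on the square class). [folklore] -/
theorem quadraticHeckeCharCM_eq_quadraticHeckeChar {θ' : 𝓞 L⁺} {β : L} (hβ2 : β ^ 2 = algebraMap L⁺ L (θ' : L⁺))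
    (hβ : β ∉ maximalRealSubfield L) (hθ' : ¬ IsSquare (θ' : L⁺)) :
    quadraticHeckeChar L⁺ θ' hθ' = quadraticHeckeCharCM L := by
  obtain ⟨α, hα0, hαc, hα2⟩ := cmQuadraticGenerator_spec L
  have hβ2mem : β ^ 2 ∈ maximalRealSubfield L := by
    rw [hβ2]
    exact SetLike.coe_mem _
  have hβc : IsCMField.complexConj L β = -β := complexConj_eq_neg_of_sq_mem hβ2mem hβ
  obtain ⟨r, hr⟩ := exists_mul_sq_eq_of_sq_eq hαc hα0 hβc hα2 hβ2
  have hr0 : (r : L⁺) ≠ 0 := by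
    rintro rfl
    rw [zero_pow two_ne_zero, mul_zero] at hr
    exact hθ' ⟨0, by rw [mul_zero]; exact_mod_cast hr⟩
  exact quadraticHeckeChar_eq_of_mul_sq (not_isSquare_cmQuadraticGenerator L) hθ' hr0 hr

/-! ## Archimedean type: `sgn` at every infinite place -/

/-- **`ε(⟨c⟩_v) = sgn(c)`** at every infinite place `v` of `L⁺` (all real, `θ` negative at each):
`1` if `c > 0`, `-1` if `c < 0`, in `L⁺_v ≅ ℝ` (`Completion.ringEquivRealOfIsReal`).
[cite: Omeara1963, §71D proof of Thm. 71:19] -/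
theorem quadraticHeckeCharCM_infiniteIdeleSingle (v : InfinitePlace L⁺) (c : (v.Completion)ˣ) :
    ((quadraticHeckeCharCM L (infiniteIdeleSingle v c) : ℂˣ) : ℂ) =
      if 0 < Completion.ringEquivRealOfIsReal (IsTotallyReal.isReal v) (c : v.Completion) then 1 else -1 :=
  quadraticHeckeChar_infiniteIdeleSingle_of_neg _ _ (embedding_cmQuadraticGenerator_lt_zero L v) c

/-- `ε(⟨c⟩_v) = 1 ↔ c > 0`. [folklore] -/
theorem quadraticHeckeCharCM_infiniteIdeleSingle_eq_one_iff (v : InfinitePlace L⁺) (c : (v.Completion)ˣ) :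
    quadraticHeckeCharCM L (infiniteIdeleSingle v c) = 1 ↔
      0 < Completion.ringEquivRealOfIsReal (IsTotallyReal.isReal v) (c : v.Completion) :=
  quadraticHeckeChar_infiniteIdeleSingle_eq_one_iff_of_neg _ _ (embedding_cmQuadraticGenerator_lt_zero L v) c

/-- **`ε(y, 1) = ∏_v sgn(y_v)`** for `y ∈ (L⁺ ⊗ ℝ)ˣ = L⁺_∞ˣ`: the archimedean type of `ε_{L/L⁺}` is `sgn` at every
(real) place of `L⁺`. [cite: Omeara1963, §71D proof of Thm. 71:19] -/
theorem quadraticHeckeCharCM_infiniteIdeles (y : (InfiniteAdeleRing L⁺)ˣ) :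
    ((quadraticHeckeCharCM L (infiniteIdeles L⁺ y) : ℂˣ) : ℂ) =
      ∏ v : InfinitePlace L⁺,
        (if 0 < Completion.ringEquivRealOfIsReal (IsTotallyReal.isReal v) ((y : InfiniteAdeleRing L⁺) v)
          then (1 : ℂ) else -1) :=
  quadraticHeckeChar_infiniteIdeles_of_forall_neg _ (embedding_cmQuadraticGenerator_lt_zero L) y

/-- If every `y_v > 0` then `ε(y, 1) = 1`. [folklore] -/
theorem quadraticHeckeCharCM_infiniteIdeles_eq_one_of_forall_pos (y : (InfiniteAdeleRing L⁺)ˣ)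
    (hpos : ∀ v : InfinitePlace L⁺,
      0 < Completion.ringEquivRealOfIsReal (IsTotallyReal.isReal v) ((y : InfiniteAdeleRing L⁺) v)) :
    quadraticHeckeCharCM L (infiniteIdeles L⁺ y) = 1 :=
  quadraticHeckeChar_infiniteIdeles_eq_one_of_forall_pos _ y fun v _ => hpos v

variable (L) in
/-- **`ε_{L/L⁺} ≠ 1`**: at any infinite place `v` of `L⁺`, `ε(⟨-1⟩_v) = -1`. [folklore] -/
theorem quadraticHeckeCharCM_ne_one : quadraticHeckeCharCM L ≠ 1 := by
  obtain ⟨v⟩ : Nonempty (InfinitePlace L⁺) := inferInstance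
  intro h
  have h1 := (quadraticHeckeCharCM_infiniteIdeleSingle_eq_one_iff v (-1)).1 (by rw [h, HeckeCharacter.one_apply])
  rw [Units.val_neg, Units.val_one, map_neg, map_one] at h1
  linarith

/-! ## Unitary (circle-valued) form on the idèle class group -/

variable (L)

section Circle

variable {G : Type*} [Monoid G] [TopologicalSpace G]

/-- A continuous quasi-character `ψ : G → ℂˣ` whose values have norm `1`, as a continuous homomorphism into the
unit circle `S¹ ⊂ ℂ` (Mathlib `Circle`). [folklore] -/
def unitaryToCircle (ψ : G →ₜ* ℂˣ) (h : ∀ g, ‖((ψ g : ℂˣ) : ℂ)‖ = 1) : G →ₜ* Circle where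
  toFun g := ⟨((ψ g : ℂˣ) : ℂ), mem_sphere_zero_iff_norm.2 (h g)⟩
  map_one' := Circle.ext (by
    change ((ψ 1 : ℂˣ) : ℂ) = ((1 : Circle) : ℂ)
    rw [map_one, Units.val_one, Circle.coe_one])
  map_mul' a b := Circle.ext (by
    change ((ψ (a * b) : ℂˣ) : ℂ) = (ψ a : ℂ) * (ψ b : ℂ)
    rw [map_mul, Units.val_mul])
  continuous_toFun := (Units.continuous_val.comp ψ.continuous).subtype_mk _

/-- The value of `unitaryToCircle ψ` in `ℂ` is the value of `ψ`. [folklore] -/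
@[simp]
theorem coe_unitaryToCircle_apply (ψ : G →ₜ* ℂˣ) (h : ∀ g, ‖((ψ g : ℂˣ) : ℂ)‖ = 1) (g : G) :
    ((unitaryToCircle ψ h g : Circle) : ℂ) = ((ψ g : ℂˣ) : ℂ) := rfl

end Circle

/-- The values of `ε` have norm `1` (they are `±1`). [folklore] -/
theorem norm_quadraticHeckeCharCM_apply (x : ideleGroup L⁺) : ‖((quadraticHeckeCharCM L x : ℂˣ) : ℂ)‖ = 1 := by
  have h : ((quadraticHeckeCharCM L x : ℂˣ) : ℂ) ^ 2 = 1 := by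
    rw [← Units.val_pow_eq_pow_val, quadraticHeckeCharCM_apply_sq, Units.val_one]
  have h' : ‖((quadraticHeckeCharCM L x : ℂˣ) : ℂ)‖ ^ 2 = 1 := by rw [← norm_pow, h, norm_one]
  exact (pow_eq_one_iff_of_nonneg (norm_nonneg _) two_ne_zero).1 h'

/-- **`ε_{L/L⁺}` as a continuous unitary character of the idèle class group `C_{L⁺}`** (values in `S¹`; the
tree's `HeckeCharacter.toIdeleClassCharacter` followed by `unitaryToCircle`). [cite: Omeara1963, §65D Prop. 65:21] -/
def quadraticClassCharCM : IdeleClassGroup L⁺ →ₜ* Circle :=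
  unitaryToCircle (quadraticHeckeCharCM L).toIdeleClassCharacter fun c =>
    QuotientGroup.induction_on c fun x => norm_quadraticHeckeCharCM_apply L x

variable {L} in
/-- On the class `[x]` of an idèle, `quadraticClassCharCM L [x] = ε(x)` (as complex numbers). [folklore] -/
@[simp]
theorem coe_quadraticClassCharCM_mk (x : ideleGroup L⁺) :
    ((quadraticClassCharCM L (x : IdeleClassGroup L⁺) : Circle) : ℂ) = ((quadraticHeckeCharCM L x : ℂˣ) : ℂ) :=
  rfl

variable {L} in
/-- Kernel of the class character: `[x] ↦ 1` iff `x ∈ P_{L⁺} · N J`. [cite: Omeara1963, §65A Example 65:2] -/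
theorem quadraticClassCharCM_mk_eq_one_iff (x : ideleGroup L⁺) :
    quadraticClassCharCM L (x : IdeleClassGroup L⁺) = 1 ↔
      x ∈ principalIdeles L⁺ ⊔ normIdeles L⁺ (cmQuadraticGenerator L : L⁺) := by
  rw [← quadraticHeckeCharCM_apply_eq_one_iff, ← Circle.coe_eq_one, coe_quadraticClassCharCM_mk, Units.val_eq_one]

variable {L} in
/-- `quadraticClassCharCM L c ^ 2 = 1`. [folklore] -/
theorem quadraticClassCharCM_sq (c : IdeleClassGroup L⁺) : quadraticClassCharCM L c ^ 2 = 1 := by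
  induction c using QuotientGroup.induction_on with
  | H x =>
    apply Circle.ext
    rw [Circle.coe_pow, coe_quadraticClassCharCM_mk, ← Units.val_pow_eq_pow_val, quadraticHeckeCharCM_apply_sq,
      Units.val_one, Circle.coe_one]

variable {L} in
/-- **Values on `[L⁺_∞ˣ]`: `quadraticClassCharCM L [y] = ∏_v sgn(y_v)`** for `y ∈ L⁺_∞ˣ` (classes via the tree's
`infUnitsToClass`). [cite: Omeara1963, §71D proof of Thm. 71:19] -/
theorem coe_quadraticClassCharCM_infUnitsToClass (y : (InfiniteAdeleRing L⁺)ˣ) :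
    ((quadraticClassCharCM L (infUnitsToClass L⁺ y) : Circle) : ℂ) =
      ∏ v : InfinitePlace L⁺,
        (if 0 < Completion.ringEquivRealOfIsReal (IsTotallyReal.isReal v) ((y : InfiniteAdeleRing L⁺) v)
          then (1 : ℂ) else -1) := by
  rw [infUnitsToClass_apply, coe_quadraticClassCharCM_mk, quadraticHeckeCharCM_infiniteIdeles]

variable {L} in
/-- `quadraticClassCharCM L [y] = 1` when every `y_v > 0`. [folklore] -/
theorem quadraticClassCharCM_infUnitsToClass_eq_one_of_forall_pos (y : (InfiniteAdeleRing L⁺)ˣ)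
    (hpos : ∀ v : InfinitePlace L⁺,
      0 < Completion.ringEquivRealOfIsReal (IsTotallyReal.isReal v) ((y : InfiniteAdeleRing L⁺) v)) :
    quadraticClassCharCM L (infUnitsToClass L⁺ y) = 1 := by
  rw [← Circle.coe_eq_one, infUnitsToClass_apply, coe_quadraticClassCharCM_mk, Units.val_eq_one]
  exact quadraticHeckeCharCM_infiniteIdeles_eq_one_of_forall_pos y hpos

variable {L} in
/-- Values on the class of a one-place idèle `⟨c⟩_v`: `sgn(c)`. [folklore] -/
theorem coe_quadraticClassCharCM_infiniteIdeleSingle (v : InfinitePlace L⁺) (c : (v.Completion)ˣ) :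
    ((quadraticClassCharCM L (infiniteIdeleSingle v c : IdeleClassGroup L⁺) : Circle) : ℂ) =
      if 0 < Completion.ringEquivRealOfIsReal (IsTotallyReal.isReal v) (c : v.Completion) then 1 else -1 := by
  rw [coe_quadraticClassCharCM_mk, quadraticHeckeCharCM_infiniteIdeleSingle]

/-- `quadraticClassCharCM L ≠ 1`. [folklore] -/
theorem quadraticClassCharCM_ne_one : quadraticClassCharCM L ≠ 1 := by
  intro h
  apply quadraticHeckeCharCM_ne_one L
  ext1 x
  have hx : quadraticClassCharCM L (x : IdeleClassGroup L⁺) = 1 := by rw [h]; rfl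
  rw [← Circle.coe_eq_one, coe_quadraticClassCharCM_mk, Units.val_eq_one] at hx
  rw [hx, HeckeCharacter.one_apply]

/-! ## The base change `C_{L⁺} → C_L` -/

/-- **`ι : C_{L⁺} → C_L` is a closed embedding** (injective as `L/L⁺` is Galois, continuous, proper).
[cite: CasselsFrohlichANT1967, Ch. II §16] -/
theorem isClosedEmbedding_classBaseChange_maximalRealSubfield :
    Topology.IsClosedEmbedding (classBaseChange (maximalRealSubfield L) L) :=
  isClosedEmbedding_classBaseChange _ _

/-- **`‖ι c‖_L = ‖c‖²_{L⁺}`** (`[L : L⁺] = 2`). [cite: CasselsFrohlichANT1967, Ch. II §11] -/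
theorem norm_classBaseChange_maximalRealSubfield (c : IdeleClassGroup L⁺) :
    IdeleClassGroup.norm L (classBaseChange (maximalRealSubfield L) L c) = IdeleClassGroup.norm L⁺ c ^ 2 := by
  rw [norm_classBaseChange, Algebra.IsQuadraticExtension.finrank_eq_two]

end Literature.NumberTheory.Automorphic

end
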